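import Literature.Probability.RandomPlanarGeometry.ExcursionPathInputs
import Literature.Probability.Process.BrownianVecTransience
import Literature.Probability.Process.BrownianVecModel
import HarnessLib

/-!
# [LSW] Prop. 4.1: the Brownian excursion avoids `A ∈ 𝒬*` with probability `Φ'_A(0)`; hence `P_1` exists

Proof-only file (no definition, no named fact), after

* G. F. Lawler, O. Schramm, W. Werner, *Conformal restriction: the chordal case*, J. Amer.
  Math. Soc. **16** (2003) 917–955, arXiv:math/0209343 (**[LSW]**), §4, Prop. 4.1 (p. 16):
  "For all `A ∈ 𝒬*`, `P[B[0, ∞) ∩ A = ∅] = Φ_A'(0)`", with its proof: "Suppose that `Z` is a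
  Brownian excursion in `ℍ` starting at `z ∈ ℍ ∖ A`. It will be (up to time-change) a Brownian
  excursion in `ℍ ∖ A` if and only if `M_{T_A} = 1`, i.e. `P[Z ⊂ ℍ ∖ A] = M_0 = Im Φ(z)/Im z`.
  [...] `P[B[0, ∞) ∩ A = ∅] = lim_{s→0} P[B[s, ∞) ∩ A = ∅] = lim_{s→0} E[Im Φ(B_s)/Im B_s] =
  Φ'(0)`", and the sentence following it: "We have just proved that the two-sided restriction
  measure `P_1` exists".

The excursion is realised, as on p. 16 of [LSW] ("a three-dimensional Bessel process is the
modulus of a three-dimensional Brownian motion"), by a four-dimensional Brownian motion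
`W = (W⁰, w)` (`Process.IsBrownianVec`, here `d = 4`; the concrete model
`Process.brownianQuad` on `Process.wienerQuad` of `Process/BrownianVecModel`) through
`B_t = exPt (W_t) = W⁰_t + i|w_t|` (`ExcursionRestrictionHarmonic`). The martingale argument of
the printed proof (Itô's formula for `M_t = Im Φ(Z_t)/Im Z_t`) is replaced by its harmonic
form: `U = Im Φ(x + i|w|)/|w|` is harmonic on `D_A ⊆ ℝ⁴` (`lap_excursionRatio_eq_zero`), so the
optional stopping identity `E[U(a + W_{t ∧ T_F})] = U(a)` of `Process/BrownianVecHarmonic`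
(`integral_stoppedProcess_eq_of_harmonic'`) applies outside the closed obstacles
`F_δ = {dist(·, exPt⁻¹ A) ≤ δ} ∪ {|w| ≤ δ}`, on which `0 < U ≤ 1`. Contents,
everything PROVED:

* `tendsto_stoppedProcess_excursionRatio_obstacle` — **pathwise limit of the stopped values**: along a
  path which never meets the axis and whose spatial radius tends to `∞` (almost every path:
  `Process.IsBrownianVec.measure_exists_spRad_eq_zero`, `….ae_tendsto_spRad_atTop` of
  `Process/BrownianVecTransience`), `U(a + W_{k ∧ T_{F_{δ_k}}}) → 𝟙{the excursion never meets A}`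
  as `k → ∞`, `δ_k → 0` (on avoidance by `1 − C/|w| ≤ U ≤ 1`, `one_sub_div_le_excursionRatio`;
  on hitting by `U → 0` at the points over `A ∩ ℍ`, `tendsto_excursionRatio_of_mem`);
* `measureReal_hitTime_eq_top` — **`P[a + W never meets exPt⁻¹ A] = U(a)` for `a ∈ D_A`**
  ("`P[Z ⊂ ℍ ∖ A] = M_0 = Im Φ(z)/Im z`"), by dominated convergence;
* `measureReal_exists_mem_preimage_exPt` — **`P[B[s, ∞) ∩ A ≠ ∅] = 1 − E[Ū(W_s)]`** for `s > 0`
  (weak Markov property at time `s`, `Process.IsBrownianVec.measureReal_shift_mem_eq_integral`,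
  through a measurable description of the hit event by a countable dense set of times,
  `Process.exists_le_mem_iff_forall_exists_infDist_lt`; the marginal `W_s` is off the axis a.s.);
* `tendsto_integral_indicator_excursionRatio` — **`E[Ū(W_{1/(n+1)})] → Φ'_A(0)`**
  (`tendsto_excursionRatio_nhdsWithin_zero`, dominated convergence);
* `measure_forall_exPt_notMem` — **[LSW] Prop. 4.1**: `P[∀ t, exPt (W_t) ∉ A] = Φ'_A(0)` for
  every `A ∈ 𝒬*` (monotone continuity in `s ↓ 0`; `A = ∅` by
  `ExcursionCloud.eq_one_of_hasRestrictionDeriv_empty`);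
* `exists_isRestrictionMeasure_one_of_isBrownianVec`, `exists_isRestrictionMeasure_one_brownianQuad`
  — **the two-sided restriction measure `P_1` exists** (the tree's assembly
  `exists_isRestrictionMeasure_one_of_excursionProcess` of `ExcursionPathInputs` fed with the
  four-dimensional Brownian motion), and the consequences recorded there
  (`LawlerSchrammWerner2003_brownianQuad`).

## References

* [LSW] §4 p. 16, Prop. 4.1 and its proof. [LawlerSchrammWerner2003Restriction]
* J.-F. Le Gall, *Brownian Motion, Martingales, and Stochastic Calculus*, GTM 274 (2016), Ch. 2
  (simple Markov property), Ch. 7 Prop. 7.16, Thm. 7.17 (polarity of points and transience in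
  `d = 3`). [Legall2016]
-/

noncomputable section

open Set Filter Metric Function MeasureTheory
open _root_.Topology
open UpperHalfPlane (upperHalfPlaneSet)
open Literature.Probability.Process
open scoped NNReal ENNReal

namespace Literature.Probability.RandomPlanarGeometry

variable {Ω : Type*} {mΩ : MeasurableSpace Ω} {P : Measure Ω} {W : ℝ≥0 → Ω → (Fin 4 → ℝ)}
  {A : Set ℂ} {Φ : ConformalEquiv (upperHalfPlaneSet \ A) upperHalfPlaneSet}

/-! ### The lifted hull `exPt⁻¹ A ⊆ ℝ⁴` and the obstacles -/

/-- The lifted hull of a closed set is closed. [folklore] -/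
theorem isClosed_preimage_exPt (hA : IsClosed A) : IsClosed (exPt ⁻¹' A) :=
  hA.preimage continuous_exPt

/-- The lifted hull of a nonempty hull is nonempty (a hull lies in `{Im ≥ 0}`). [folklore] -/
theorem preimage_exPt_nonempty (hA : IsStarHull A) (hne : A.Nonempty) : (exPt ⁻¹' A).Nonempty := by
  obtain ⟨z, hz⟩ := hne
  have him : 0 ≤ z.im := by
    have h := hA.1.subset_closure hz
    rw [show upperHalfPlaneSet = {w : ℂ | 0 < w.im} from rfl, Complex.closure_setOf_lt_im] at h
    exact h
  refine ⟨![z.re, z.im, 0, 0], ?_⟩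
  have e1 : (![z.re, z.im, 0, 0] : Fin 4 → ℝ) 1 = z.im := rfl
  have e2 : (![z.re, z.im, 0, 0] : Fin 4 → ℝ) 2 = 0 := rfl
  have e3 : (![z.re, z.im, 0, 0] : Fin 4 → ℝ) 3 = 0 := rfl
  have h1 : exRad ![z.re, z.im, 0, 0] = z.im := by
    rw [exRad, e1, e2, e3]
    simp [Real.sqrt_sq him]
  have h : exPt ![z.re, z.im, 0, 0] = z := Complex.ext rfl (by rw [exPt_im, h1])
  show exPt _ ∈ A
  rw [h]
  exact hz

/-- `|Ū| ≤ 1` for the measurable version `Ū = 𝟙_{D_A} U`. [folklore] -/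
theorem abs_indicator_excursionRatio_le_one (hA : IsStarHull A) (hΦ : IsRestrictionMap A Φ)
    (p : Fin 4 → ℝ) : |(exDom A).indicator (excursionRatio Φ) p| ≤ 1 := by
  by_cases hp : p ∈ exDom A
  · rw [indicator_of_mem hp, abs_of_pos (excursionRatio_pos hp)]
    exact excursionRatio_le_one hA.1.1 hΦ hp
  · rw [indicator_of_notMem hp, abs_zero]
    exact zero_le_one

/-- `|U| ≤ 1` on `D_A`. [folklore] -/
theorem abs_excursionRatio_le_one (hA : IsStarHull A) (hΦ : IsRestrictionMap A Φ)
    {p : Fin 4 → ℝ} (hp : p ∈ exDom A) : |excursionRatio Φ p| ≤ 1 := by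
  rw [abs_of_pos (excursionRatio_pos hp)]
  exact excursionRatio_le_one hA.1.1 hΦ hp

/-- **The closed obstacles** `F_δ(A) = {p : dist(p, exPt⁻¹ A) ≤ δ} ∪ {p : |w| ≤ δ}` are closed.
[folklore] -/
theorem isClosed_obstacle (A : Set ℂ) (δ : ℝ) :
    IsClosed ({p : Fin 4 → ℝ | infDist p (exPt ⁻¹' A) ≤ δ} ∪ {p | exRad p ≤ δ}) :=
  (isClosed_le (continuous_infDist_pt _) continuous_const).union
    (isClosed_le continuous_exRad continuous_const)

/-- The lifted hull lies in every obstacle with `δ ≥ 0`. [folklore] -/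
theorem preimage_subset_obstacle (A : Set ℂ) {δ : ℝ} (hδ : 0 ≤ δ) :
    exPt ⁻¹' A ⊆ {p : Fin 4 → ℝ | infDist p (exPt ⁻¹' A) ≤ δ} ∪ {p | exRad p ≤ δ} :=
  fun p hp ↦ Or.inl (show infDist p (exPt ⁻¹' A) ≤ δ by rw [infDist_zero_of_mem hp]; exact hδ)

/-- A point at distance `> δ` from the lifted hull with `|w| > δ` is outside `F_δ`. [folklore] -/
theorem notMem_obstacle {δ : ℝ} {p : Fin 4 → ℝ} (h1 : δ < infDist p (exPt ⁻¹' A))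
    (h2 : δ < exRad p) : p ∉ {p : Fin 4 → ℝ | infDist p (exPt ⁻¹' A) ≤ δ} ∪ {p | exRad p ≤ δ} := by
  rintro (h | h)
  · have h' : infDist p (exPt ⁻¹' A) ≤ δ := h
    exact lt_irrefl _ (h'.trans_lt h1)
  · have h' : exRad p ≤ δ := h
    exact lt_irrefl _ (h'.trans_lt h2)

/-- For `δ > 0` (and a nonempty lifted hull), `closure (F_δ)ᶜ ⊆ D_A`. [folklore] -/
theorem closure_compl_obstacle_subset (hA : IsClosed A) (hne : (exPt ⁻¹' A).Nonempty) {δ : ℝ}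
    (hδ : 0 < δ) :
    closure ({p : Fin 4 → ℝ | infDist p (exPt ⁻¹' A) ≤ δ} ∪ {p | exRad p ≤ δ})ᶜ ⊆ exDom A := by
  have hS : IsClosed {p : Fin 4 → ℝ | δ ≤ infDist p (exPt ⁻¹' A) ∧ δ ≤ exRad p} :=
    (isClosed_le continuous_const (continuous_infDist_pt _)).inter
      (isClosed_le continuous_const continuous_exRad)
  refine (closure_minimal (fun p hp ↦ ?_) hS).trans fun p hp ↦ ?_
  · simp only [mem_compl_iff, mem_union, mem_setOf_eq, not_or, not_le] at hp
    exact ⟨hp.1.le, hp.2.le⟩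
  · refine ⟨(hδ.trans_le hp.2).ne', fun hpA ↦ ?_⟩
    exact ((isClosed_preimage_exPt hA).notMem_iff_infDist_pos hne).2 (hδ.trans_le hp.1) hpA

/-- **The obstacles shrink to the lifted hull and the axis**: a compact subset of `D_A` is
disjoint from `F_{δ_k}` eventually, when `δ_k → 0` (the continuous positive function
`dist(·, exPt⁻¹ A) ∧ |w|` has a positive minimum on it). [folklore] -/
theorem eventually_disjoint_obstacle (hA : IsClosed A) (hne : (exPt ⁻¹' A).Nonempty) {δ : ℕ → ℝ}
    (hδ0 : Tendsto δ atTop (𝓝 0)) {K : Set (Fin 4 → ℝ)} (hK : IsCompact K) (hKD : K ⊆ exDom A) :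
    ∀ᶠ k in atTop, Disjoint K ({p : Fin 4 → ℝ | infDist p (exPt ⁻¹' A) ≤ δ k} ∪ {p | exRad p ≤ δ k}) := by
  rcases K.eq_empty_or_nonempty with rfl | hKne
  · exact Eventually.of_forall fun k ↦ empty_disjoint _
  set g : (Fin 4 → ℝ) → ℝ := fun p ↦ min (infDist p (exPt ⁻¹' A)) (exRad p) with hgdef
  have hgc : Continuous g := (continuous_infDist_pt _).min continuous_exRad
  obtain ⟨p₀, hp₀, hmin⟩ := hK.exists_isMinOn hKne hgc.continuousOn
  have hm : 0 < g p₀ :=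
    lt_min (((isClosed_preimage_exPt hA).notMem_iff_infDist_pos hne).1 (hKD hp₀).2)
      (exRad_pos (hKD hp₀).1)
  filter_upwards [(tendsto_order.1 hδ0).2 _ hm] with k hk
  refine Set.disjoint_left.2 fun p hp hpF ↦ ?_
  have hgp : g p₀ ≤ g p := isMinOn_iff.1 hmin p hp
  have hg1 : g p ≤ infDist p (exPt ⁻¹' A) := min_le_left _ _
  have hg2 : g p ≤ exRad p := min_le_right _ _
  rcases hpF with h | h
  · have h' : infDist p (exPt ⁻¹' A) ≤ δ k := h
    linarith
  · have h' : exRad p ≤ δ k := h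
    linarith

/-- `{T_F = ⊤}` is measurable (closed `F`). [folklore] -/
theorem measurableSet_hitTime_eq_top (hW : IsBrownianVec W P) {x₀ : Fin 4 → ℝ}
    {F : Set (Fin 4 → ℝ)} (hF : IsClosed F) :
    MeasurableSet {ω | IsBrownianVec.hitTime x₀ W F ω = ⊤} := by
  have h : {ω | IsBrownianVec.hitTime x₀ W F ω = ⊤} =
      (⋃ n : ℕ, {ω | IsBrownianVec.hitTime x₀ W F ω ≤ (n : ℝ≥0)})ᶜ := by
    ext ω
    simp only [mem_setOf_eq, mem_compl_iff, mem_iUnion, not_exists]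
    constructor
    · intro h n hle
      rw [h] at hle
      exact WithTop.not_top_le_coe _ hle
    · intro h
      by_contra hne
      obtain ⟨T, hT⟩ := WithTop.ne_top_iff_exists.1 hne
      obtain ⟨n, hn⟩ := exists_nat_ge T
      exact h n (by rw [← hT]; exact_mod_cast hn)
  rw [h]
  exact (MeasurableSet.iUnion fun n : ℕ ↦
    hW.natFiltration.le _ _ ((hW.isStoppingTime_hitTime hF).measurableSet_le (n : ℝ≥0))).compl

/-! ### The pathwise limit of the stopped values of `U` -/

/-- **Stopped values of `U` along a transient path off the axis.** Let `a + W(ω)` be a continuous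
path which never meets the axis `{w = 0}` and has `|w| → ∞`; let `F_k` be closed sets containing
the lifted hull `exPt⁻¹ A`, not containing `a`, with `closure (F_k)ᶜ ⊆ D_A`, and eventually
disjoint from each compact subset of `D_A`. Then `U(a + W_{k ∧ T_{F_k}}) → 1` if the excursion
`exPt (a + W)` never meets `A` (the stopped clock eventually exceeds any `S`, and
`1 − C/|w| ≤ U ≤ 1`), and `→ 0` if it does (the stopped points converge inside `D_A` to the
hitting point, over `A ∩ ℍ`, where `U → 0`): the two halves of "`Z` is a Brownian excursion in
`ℍ ∖ A` if and only if `M_{T_A} = 1`". [cite: LawlerSchrammWerner2003Restriction, proof of Prop. 4.1 (p. 16)] -/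
theorem tendsto_stoppedProcess_excursionRatio_obstacle (hW : IsBrownianVec W P) (hA : IsStarHull A)
    (hΦ : IsRestrictionMap A Φ) {a : Fin 4 → ℝ} {F : ℕ → Set (Fin 4 → ℝ)}
    (hFc : ∀ k, IsClosed (F k)) (hHF : ∀ k, exPt ⁻¹' A ⊆ F k)
    (hFD : ∀ k, closure (F k)ᶜ ⊆ exDom A) (haF : ∀ k, a ∉ F k)
    (hshrink : ∀ K : Set (Fin 4 → ℝ), IsCompact K → K ⊆ exDom A → ∀ᶠ k in atTop, Disjoint K (F k))
    {ω : Ω} (hoff : ∀ s, exRad (a + W s ω) ≠ 0)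
    (hfar : Tendsto (fun t ↦ exRad (a + W t ω)) atTop atTop) :
    Tendsto (fun k : ℕ ↦ stoppedProcess (fun r ω ↦ excursionRatio Φ (a + W r ω))
        (IsBrownianVec.hitTime a W (F k)) (k : ℝ≥0) ω)
      atTop (𝓝 ({ω | IsBrownianVec.hitTime a W (exPt ⁻¹' A) ω = ⊤}.indicator 1 ω)) := by
  have hHc : IsClosed (exPt ⁻¹' A) := isClosed_preimage_exPt hA.1.isClosed
  -- the path, the stopped clocks and the stopped points
  set X : ℝ≥0 → (Fin 4 → ℝ) := fun s ↦ a + W s ω with hXdef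
  have hXc : Continuous X := continuous_const.add (hW.continuous_path ω)
  set τ : ℕ → ℝ≥0 := fun k ↦
    (min ((k : ℝ≥0) : WithTop ℝ≥0) (IsBrownianVec.hitTime a W (F k) ω)).untopA with hτdef
  have hXD : ∀ k, X (τ k) ∈ exDom A := fun k ↦
    hFD k (hW.mem_closure_compl_of_le (hFc k) (haF k) (k : ℝ≥0) ω le_rfl)
  have hval : (fun k : ℕ ↦ stoppedProcess (fun r ω ↦ excursionRatio Φ (a + W r ω))
      (IsBrownianVec.hitTime a W (F k)) (k : ℝ≥0) ω) = fun k ↦ excursionRatio Φ (X (τ k)) := rfl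
  rw [hval]
  -- the stopped clock eventually exceeds any time up to which the excursion stays off `A`
  have hL : ∀ S : ℝ≥0, (∀ j ≤ S, X j ∉ exPt ⁻¹' A) → ∀ᶠ k : ℕ in atTop, S ≤ τ k := by
    intro S hS
    have hKc : IsCompact (X '' Icc 0 S) := isCompact_Icc.image hXc
    have hKD : X '' Icc 0 S ⊆ exDom A := by
      rintro _ ⟨j, hj, rfl⟩
      exact ⟨hoff j, hS j hj.2⟩
    obtain ⟨N, hN⟩ := exists_nat_ge S
    filter_upwards [hshrink _ hKc hKD, eventually_ge_atTop N] with k hk1 hk2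
    have hkS : S ≤ (k : ℝ≥0) := hN.trans (by exact_mod_cast hk2)
    have hnot : ∀ j ≤ S, X j ∉ F k := fun j hj ↦
      Set.disjoint_left.1 hk1 (mem_image_of_mem X ⟨bot_le, hj⟩)
    have hSlt : (S : WithTop ℝ≥0) < IsBrownianVec.hitTime a W (F k) ω := by
      by_contra hle
      obtain ⟨j, hj, hjF⟩ := (hW.hitTime_le_coe_iff (hFc k)).1 (not_lt.1 hle)
      exact hnot j hj hjF
    show S ≤ (min ((k : ℝ≥0) : WithTop ℝ≥0) (IsBrownianVec.hitTime a W (F k) ω)).untopA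
    induction hT : IsBrownianVec.hitTime a W (F k) ω with
    | top => rw [untopA_min_coe_top]; exact hkS
    | coe T' =>
      rw [untopA_min_coe_coe]
      rw [hT] at hSlt
      exact le_min hkS (by exact_mod_cast hSlt.le)
  by_cases hT : IsBrownianVec.hitTime a W (exPt ⁻¹' A) ω = ⊤
  · -- the excursion never meets `A`: the stopped values tend to `1`
    rw [indicator_of_mem (show ω ∈ {ω | IsBrownianVec.hitTime a W (exPt ⁻¹' A) ω = ⊤} from hT),
      Pi.one_apply]
    have hnoH : ∀ j, X j ∉ exPt ⁻¹' A := fun j ↦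
      notMem_of_coe_lt_hittingAfter_zero (u := fun t ω ↦ a + W t ω) (s := exPt ⁻¹' A)
        (by rw [show hittingAfter (fun t ω ↦ a + W t ω) (exPt ⁻¹' A) 0 ω =
          IsBrownianVec.hitTime a W (exPt ⁻¹' A) ω from rfl, hT]; exact WithTop.coe_lt_top j)
    obtain ⟨C, hC⟩ := one_sub_div_le_excursionRatio hA hΦ
    rw [Metric.tendsto_atTop]
    intro ε hε
    obtain ⟨R, hR0, hR⟩ : ∃ R : ℝ, 0 < R ∧ |C| < ε * R := by
      refine ⟨|C| / ε + 1, by positivity, ?_⟩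
      have hε' : ε ≠ 0 := hε.ne'
      have : ε * (|C| / ε + 1) = |C| + ε := by field_simp
      rw [this]
      linarith
    obtain ⟨S, hS⟩ := tendsto_atTop_atTop.1 hfar R
    obtain ⟨K, hK⟩ := eventually_atTop.1 (hL S fun j _ ↦ hnoH j)
    refine ⟨K, fun k hk ↦ ?_⟩
    have hD := hXD k
    have hRk : R ≤ exRad (X (τ k)) := hS _ (hK k hk)
    have hrpos : 0 < exRad (X (τ k)) := hR0.trans_le hRk
    have h1 : 1 - ε < excursionRatio Φ (X (τ k)) := by
      have hle := hC _ hD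
      have hlt : C / exRad (X (τ k)) < ε := by
        rw [div_lt_iff₀ hrpos]
        calc C ≤ |C| := le_abs_self C
          _ < ε * R := hR
          _ ≤ ε * exRad (X (τ k)) := by gcongr
      linarith
    have h2 : excursionRatio Φ (X (τ k)) ≤ 1 := excursionRatio_le_one hA.1.1 hΦ hD
    rw [Real.dist_eq, abs_sub_lt_iff]
    constructor <;> linarith
  · -- the excursion meets `A` at the finite time `T`: the stopped values tend to `0`
    rw [indicator_of_notMem (show ω ∉ {ω | IsBrownianVec.hitTime a W (exPt ⁻¹' A) ω = ⊤} from hT)]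
    obtain ⟨T, hT'⟩ := WithTop.ne_top_iff_exists.1 hT
    have hXT : X T ∈ exPt ⁻¹' A := hW.mem_of_hitTime_eq_coe hHc hT'.symm
    have hbefore : ∀ j < T, X j ∉ exPt ⁻¹' A := fun j hj ↦
      notMem_of_coe_lt_hittingAfter_zero (u := fun t ω ↦ a + W t ω) (s := exPt ⁻¹' A)
        (by rw [show hittingAfter (fun t ω ↦ a + W t ω) (exPt ⁻¹' A) 0 ω =
          IsBrownianVec.hitTime a W (exPt ⁻¹' A) ω from rfl, ← hT']; exact_mod_cast hj)
    have hτle : ∀ k, τ k ≤ T := fun k ↦ by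
      have h1 : IsBrownianVec.hitTime a W (F k) ω ≤ T := by
        rw [hT']
        exact IsBrownianVec.hitTime_mono (hHF k) ω
      obtain ⟨T', hT''⟩ := WithTop.ne_top_iff_exists.1 (ne_top_of_le_ne_top WithTop.coe_ne_top h1)
      show (min ((k : ℝ≥0) : WithTop ℝ≥0) (IsBrownianVec.hitTime a W (F k) ω)).untopA ≤ T
      rw [← hT''] at h1 ⊢
      rw [untopA_min_coe_coe]
      exact (min_le_right _ _).trans (by exact_mod_cast h1)
    have hτT : Tendsto τ atTop (𝓝 T) := by
      rw [tendsto_order]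
      refine ⟨fun S hS ↦ ?_, fun S hS ↦ Eventually.of_forall fun k ↦ (hτle k).trans_lt hS⟩
      obtain ⟨S', hSS', hS'T⟩ := exists_between hS
      filter_upwards [hL S' fun j hj ↦ hbefore j (hj.trans_lt hS'T)] with k hk
      exact hSS'.trans_le hk
    have hlim : Tendsto (fun k ↦ X (τ k)) atTop (𝓝[exDom A] (X T)) :=
      tendsto_nhdsWithin_iff.2 ⟨(hXc.tendsto T).comp hτT, Eventually.of_forall hXD⟩
    exact (tendsto_excursionRatio_of_mem hA hΦ (hoff T) hXT).comp hlim

/-! ### `P[the excursion from a avoids A] = U(a)` -/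

/-- **`P[a + W never meets exPt⁻¹ A] = U(a) = Im Φ_A(z)/Im z`** for `a ∈ D_A` over `z = exPt a`
("`P[Z ⊂ ℍ ∖ A] = M_0 = Im Φ(z)/Im z`"): optional stopping for the harmonic `U` outside the
obstacles `F_{δ_k}`, `δ_k = η/(k + 2)` with `η = dist(a, exPt⁻¹ A) ∧ |w(a)|`, then dominated
convergence along `tendsto_stoppedProcess_excursionRatio_obstacle`.
[cite: LawlerSchrammWerner2003Restriction, proof of Prop. 4.1 (p. 16)] -/
theorem measureReal_hitTime_eq_top [IsProbabilityMeasure P] (hW : IsBrownianVec W P)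
    (hA : IsStarHull A) (hne : A.Nonempty) (hΦ : IsRestrictionMap A Φ) {a : Fin 4 → ℝ}
    (ha : a ∈ exDom A) :
    P.real {ω | IsBrownianVec.hitTime a W (exPt ⁻¹' A) ω = ⊤} = excursionRatio Φ a := by
  have hAc : IsClosed A := hA.1.isClosed
  have hHc : IsClosed (exPt ⁻¹' A) := isClosed_preimage_exPt hAc
  have hHne : (exPt ⁻¹' A).Nonempty := preimage_exPt_nonempty hA hne
  -- the scales `δ k = η / (k + 2) < η = dist(a, exPt⁻¹ A) ∧ |w(a)|` and the obstacles `F k`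
  set η : ℝ := min (infDist a (exPt ⁻¹' A)) (exRad a) with hηdef
  have hη : 0 < η := lt_min ((hHc.notMem_iff_infDist_pos hHne).1 ha.2) (exRad_pos ha.1)
  set δ : ℕ → ℝ := fun k ↦ η / ((k : ℝ) + 2) with hδdef
  have hδpos : ∀ k, 0 < δ k := fun k ↦ by positivity
  have hδlt : ∀ k, δ k < η := fun k ↦ by
    show η / ((k : ℝ) + 2) < η
    rw [div_lt_iff₀ (by positivity)]
    nlinarith
  have hδ0 : Tendsto δ atTop (𝓝 0) :=
    (tendsto_atTop_add_const_right _ _ tendsto_natCast_atTop_atTop).const_div_atTop η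
  set F : ℕ → Set (Fin 4 → ℝ) := fun k ↦
    {p : Fin 4 → ℝ | infDist p (exPt ⁻¹' A) ≤ δ k} ∪ {p | exRad p ≤ δ k} with hFdef
  have hFc : ∀ k, IsClosed (F k) := fun k ↦ isClosed_obstacle A (δ k)
  have hHF : ∀ k, exPt ⁻¹' A ⊆ F k := fun k ↦ preimage_subset_obstacle A (hδpos k).le
  have hFD : ∀ k, closure (F k)ᶜ ⊆ exDom A := fun k ↦
    closure_compl_obstacle_subset hAc hHne (hδpos k)
  have haF : ∀ k, a ∉ F k := fun k ↦
    notMem_obstacle ((hδlt k).trans_le (min_le_left _ _)) ((hδlt k).trans_le (min_le_right _ _))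
  have hshrink : ∀ K : Set (Fin 4 → ℝ), IsCompact K → K ⊆ exDom A →
      ∀ᶠ k in atTop, Disjoint K (F k) := fun K hK hKD ↦
    eventually_disjoint_obstacle hAc hHne hδ0 hK hKD
  -- optional stopping outside each obstacle
  set G : ℕ → Ω → ℝ := fun k ↦ stoppedProcess (fun r ω ↦ excursionRatio Φ (a + W r ω))
    (IsBrownianVec.hitTime a W (F k)) (k : ℝ≥0) with hGdef
  have hstop : ∀ k, Integrable (G k) P ∧ ∫ ω, G k ω ∂P = excursionRatio Φ a := fun k ↦
    hW.integral_stoppedProcess_eq_of_harmonic' (isOpen_exDom hAc) (contDiffOn_excursionRatio_two hAc)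
      (fun y hy ↦ lap_excursionRatio_eq_zero hAc hy) (hFc k) (hFD k)
      (fun y hy ↦ abs_excursionRatio_le_one hA hΦ (hFD k hy)) (haF k) (k : ℝ≥0)
  -- almost every path is off the axis forever and transient
  have hae : ∀ᵐ ω ∂P, Tendsto (fun k ↦ G k ω) atTop
      (𝓝 ({ω | IsBrownianVec.hitTime a W (exPt ⁻¹' A) ω = ⊤}.indicator 1 ω)) := by
    have hoffAxis : a ∈ offAxis := mem_offAxis_iff_exRad_ne_zero.2 ha.1
    have h1 : ∀ᵐ ω ∂P, ¬ ∃ s, spRad (a + W s ω) = 0 :=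
      ae_iff.2 (by simpa only [not_not] using hW.measure_exists_spRad_eq_zero hoffAxis)
    filter_upwards [h1, hW.ae_tendsto_spRad_atTop a] with ω hω1 hω2
    push Not at hω1
    have hω1' : ∀ s, exRad (a + W s ω) ≠ 0 := fun s ↦ by rw [← spRad_eq_exRad]; exact hω1 s
    have hω2' : Tendsto (fun t ↦ exRad (a + W t ω)) atTop atTop := by
      rw [← spRad_eq_exRad]; exact hω2
    exact tendsto_stoppedProcess_excursionRatio_obstacle hW hA hΦ hFc hHF hFD haF hshrink hω1' hω2'
  -- dominated convergence (`|G k| ≤ 1`: the stopped point lies in `closure (F k)ᶜ ⊆ D_A`)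
  have hmeasT : MeasurableSet {ω | IsBrownianVec.hitTime a W (exPt ⁻¹' A) ω = ⊤} :=
    measurableSet_hitTime_eq_top hW hHc
  have hdom := tendsto_integral_of_dominated_convergence (fun _ ↦ (1 : ℝ))
    (fun k ↦ (hstop k).1.aestronglyMeasurable) (integrable_const 1)
    (fun k ↦ ae_of_all _ fun ω ↦ by
      rw [Real.norm_eq_abs]
      exact abs_excursionRatio_le_one hA hΦ
        (hFD k (hW.mem_closure_compl_of_le (hFc k) (haF k) (k : ℝ≥0) ω le_rfl)))
    hae
  rw [integral_indicator_one hmeasT] at hdom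
  have hconst : (fun k ↦ ∫ ω, G k ω ∂P) = fun _ ↦ excursionRatio Φ a := funext fun k ↦ (hstop k).2
  rw [hconst] at hdom
  exact (tendsto_nhds_unique tendsto_const_nhds hdom).symm

/-! ### The weak Markov property at time `s`: `P[B[s, ∞) ∩ A ≠ ∅] = 1 − E[Ū(W_s)]` -/

/-- **`P[∃ j, W_{s+j} ∈ exPt⁻¹ A] = 1 − E[Ū(W_s)]` for `s > 0`** ("`P[B[s, ∞) ∩ A = ∅] =
E[Im Φ(B_s)/Im B_s]`"), together with the measurability of the event: the weak Markov property
at time `s` (`Process.IsBrownianVec.measureReal_shift_mem_eq_integral`) for the hit event,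
described measurably through countable dense sets of times
(`Process.exists_le_mem_iff_forall_exists_infDist_lt`); the conditional probability given
`W_s = b` is `1 − U(b)` on `D_A` (`measureReal_hitTime_eq_top`), `1` over `A`, and `W_s` is off
the axis almost surely. [cite: LawlerSchrammWerner2003Restriction, proof of Prop. 4.1 (p. 16)] -/
theorem measureReal_exists_mem_preimage_exPt [IsProbabilityMeasure P] (hW : IsBrownianVec W P)
    (hA : IsStarHull A) (hne : A.Nonempty) (hΦ : IsRestrictionMap A Φ) {s : ℝ≥0} (hs : s ≠ 0) :
    MeasurableSet {ω | ∃ j, W (s + j) ω ∈ exPt ⁻¹' A} ∧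
      P.real {ω | ∃ j, W (s + j) ω ∈ exPt ⁻¹' A} =
        1 - ∫ ω, (exDom A).indicator (excursionRatio Φ) (W s ω) ∂P := by
  have hAc : IsClosed A := hA.1.isClosed
  have hHc : IsClosed (exPt ⁻¹' A) := isClosed_preimage_exPt hAc
  have hHne : (exPt ⁻¹' A).Nonempty := preimage_exPt_nonempty hA hne
  -- countable dense sets of times in each `[0, N]`
  have hD : ∀ N : ℕ, ∃ D : Set (Iic (N : ℝ≥0)), D.Countable ∧ Dense D := fun N ↦
    TopologicalSpace.exists_countable_dense _
  choose Dn hDc hDd using hD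
  -- the measurable hit event in (point, path)-space
  set E : Set ((Fin 4 → ℝ) × (ℝ≥0 → (Fin 4 → ℝ))) :=
    ⋃ N : ℕ, ⋂ n : ℕ, ⋃ q ∈ Dn N,
      {p | infDist (p.1 + p.2 (q : ℝ≥0)) (exPt ⁻¹' A) < 1 / ((n : ℝ) + 1)} with hEdef
  have hEm : MeasurableSet E := by
    refine MeasurableSet.iUnion fun N ↦ MeasurableSet.iInter fun n ↦
      MeasurableSet.biUnion (hDc N) fun q _ ↦ ?_
    exact measurableSet_lt ((continuous_infDist_pt _).measurable.comp
      (measurable_fst.add ((measurable_pi_apply _).comp measurable_snd))) measurable_const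
  have hEiff : ∀ (b : Fin 4 → ℝ) (γ : ℝ≥0 → (Fin 4 → ℝ)), Continuous γ →
      ((b, γ) ∈ E ↔ ∃ j, b + γ j ∈ exPt ⁻¹' A) := by
    intro b γ hγ
    have key : ∀ N : ℕ, (∃ j ≤ (N : ℝ≥0), b + γ j ∈ exPt ⁻¹' A) ↔
        ∀ n : ℕ, ∃ q ∈ Dn N, infDist (b + γ (q : ℝ≥0)) (exPt ⁻¹' A) < 1 / ((n : ℝ) + 1) :=
      fun N ↦ exists_le_mem_iff_forall_exists_infDist_lt
        (u := fun t (p : (Fin 4 → ℝ) × (ℝ≥0 → (Fin 4 → ℝ))) ↦ p.1 + p.2 t) (ω := (b, γ))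
        hHc hHne (continuous_const.add hγ) (hDd N)
    constructor
    · intro h
      obtain ⟨N, hN⟩ := mem_iUnion.1 h
      have h' : ∀ n : ℕ, ∃ q ∈ Dn N, infDist (b + γ (q : ℝ≥0)) (exPt ⁻¹' A) < 1 / ((n : ℝ) + 1) :=
        fun n ↦ by
          obtain ⟨q, hq, hq'⟩ := mem_iUnion₂.1 (mem_iInter.1 hN n)
          exact ⟨q, hq, hq'⟩
      obtain ⟨j, -, hj⟩ := (key N).2 h'
      exact ⟨j, hj⟩
    · rintro ⟨j, hj⟩
      obtain ⟨N, hN⟩ := exists_nat_ge j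
      refine mem_iUnion.2 ⟨N, mem_iInter.2 fun n ↦ ?_⟩
      obtain ⟨q, hq, hq'⟩ := (key N).1 ⟨j, hN, hj⟩ n
      exact mem_iUnion₂.2 ⟨q, hq, hq'⟩
  -- the event at time `s`
  have hev : {ω | ∃ j, W (s + j) ω ∈ exPt ⁻¹' A} = {ω | (0 + W s ω, vecShift W s ω) ∈ E} := by
    ext ω
    have hc : Continuous (vecShift W s ω) :=
      ((hW.continuous_path ω).comp (continuous_const.add continuous_id)).sub continuous_const
    rw [mem_setOf_eq, mem_setOf_eq, hEiff _ _ hc]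
    simp only [vecShift, zero_add, add_sub_cancel]
  have hmeas : MeasurableSet {ω | (0 + W s ω, vecShift W s ω) ∈ E} :=
    ((measurable_const.add (hW.measurable s)).prodMk (hW.measurable_vecShift s)) hEm
  refine ⟨hev ▸ hmeas, ?_⟩
  rw [hev, hW.measureReal_shift_mem_eq_integral 0 s hEm]
  -- the conditional probability given `W_s = b`, for `b` off the axis
  have hψ : ∀ b : Fin 4 → ℝ, exRad b ≠ 0 →
      P.real {ω' | (b, vecPath W ω') ∈ E} = 1 - (exDom A).indicator (excursionRatio Φ) b := by
    intro b hb
    have hset : {ω' | (b, vecPath W ω') ∈ E} =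
        {ω' | IsBrownianVec.hitTime b W (exPt ⁻¹' A) ω' ≠ ⊤} := by
      ext ω'
      rw [mem_setOf_eq, mem_setOf_eq, hEiff b (vecPath W ω') (hW.continuous_path ω'), IsBrownianVec.hitTime,
        hittingAfter_zero_ne_top_iff]
      rfl
    rw [hset]
    by_cases hbA : exPt b ∈ A
    · have huniv : {ω' | IsBrownianVec.hitTime b W (exPt ⁻¹' A) ω' ≠ ⊤} = univ := by
        refine eq_univ_of_forall fun ω' ↦ ?_
        show IsBrownianVec.hitTime b W (exPt ⁻¹' A) ω' ≠ ⊤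
        rw [IsBrownianVec.hitTime, hittingAfter_zero_ne_top_iff]
        exact ⟨0, by rw [hW.apply_zero, add_zero]; exact hbA⟩
      have hbD : b ∉ exDom A := fun h ↦ h.2 hbA
      rw [huniv, probReal_univ, indicator_of_notMem hbD, sub_zero]
    · have hbD : b ∈ exDom A := ⟨hb, hbA⟩
      have hcompl : {ω' | IsBrownianVec.hitTime b W (exPt ⁻¹' A) ω' ≠ ⊤} =
          {ω' | IsBrownianVec.hitTime b W (exPt ⁻¹' A) ω' = ⊤}ᶜ := by
        ext ω'
        simp
      rw [hcompl, measureReal_compl (measurableSet_hitTime_eq_top hW hHc), probReal_univ,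
        measureReal_hitTime_eq_top hW hA hne hΦ hbD, indicator_of_mem hbD]
  -- integrate: `W_s` is off the axis almost surely
  have hoff : ∀ᵐ ω ∂P, exRad (0 + W s ω) ≠ 0 := by
    have h := hW.measure_spRad_apply_eq_zero 0 hs
    rw [spRad_eq_exRad] at h
    exact ae_iff.2 (by simpa only [ne_eq, not_not] using h)
  have hŪm : Measurable ((exDom A).indicator (excursionRatio Φ)) :=
    measurable_indicator_excursionRatio hAc
  have hŪint : Integrable (fun ω ↦ (exDom A).indicator (excursionRatio Φ) (W s ω)) P :=
    IsBrownianVec.integrable_of_abs_le (hŪm.comp (hW.measurable s)) (C := 1)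
      fun ω ↦ abs_indicator_excursionRatio_le_one hA hΦ _
  calc ∫ ω, P.real {ω' | (0 + W s ω, vecPath W ω') ∈ E} ∂P
      = ∫ ω, (1 - (exDom A).indicator (excursionRatio Φ) (W s ω)) ∂P := by
        refine integral_congr_ae ?_
        filter_upwards [hoff] with ω hω
        rw [hψ _ hω, zero_add]
    _ = 1 - ∫ ω, (exDom A).indicator (excursionRatio Φ) (W s ω) ∂P := by
        rw [integral_sub (integrable_const 1) hŪint, integral_const, probReal_univ, one_smul]

/-! ### The limit `s ↓ 0` -/

/-- **`E[Ū(W_{1/(n+1)})] → Φ'_A(0)`** ("`lim_{s→0} E[Im Φ(B_s)/Im B_s] = Φ'(0)`"): almost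
surely `W_{1/(n+1)} → 0` inside `D_A` (off the axis at positive times, and eventually off the
closed set `A ∌ 0`), where `U → Φ'_A(0)` (`tendsto_excursionRatio_nhdsWithin_zero`); dominated
convergence. [cite: LawlerSchrammWerner2003Restriction, proof of Prop. 4.1 (p. 16, last display)] -/
theorem tendsto_integral_indicator_excursionRatio [IsProbabilityMeasure P] (hW : IsBrownianVec W P)
    (hA : IsStarHull A) (hΦ : IsRestrictionMap A Φ) {d : ℝ} (hd : HasRestrictionDeriv A Φ d) :
    Tendsto (fun n : ℕ ↦ ∫ ω, (exDom A).indicator (excursionRatio Φ) (W ((n : ℝ≥0) + 1)⁻¹ ω) ∂P)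
      atTop (𝓝 d) := by
  have hAc : IsClosed A := hA.1.isClosed
  have hŪm : Measurable ((exDom A).indicator (excursionRatio Φ)) :=
    measurable_indicator_excursionRatio hAc
  have hsn0 : Tendsto (fun n : ℕ ↦ ((n : ℝ≥0) + 1)⁻¹) atTop (𝓝 0) := by
    rw [← NNReal.tendsto_coe, NNReal.coe_zero]
    have h : (fun n : ℕ ↦ ((((n : ℝ≥0) + 1)⁻¹ : ℝ≥0) : ℝ)) = fun n : ℕ ↦ 1 / ((n : ℝ) + 1) := by
      funext n
      push_cast
      rw [one_div]
    rw [h]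
    exact tendsto_one_div_add_atTop_nhds_zero_nat
  have hlim : ∀ᵐ ω ∂P, Tendsto (fun n : ℕ ↦ (exDom A).indicator (excursionRatio Φ)
      (W ((n : ℝ≥0) + 1)⁻¹ ω)) atTop (𝓝 d) := by
    filter_upwards [hW.ae_forall_pos_spRad_pos 0] with ω hω
    have h0 : Tendsto (fun n : ℕ ↦ W ((n : ℝ≥0) + 1)⁻¹ ω) atTop (𝓝 0) := by
      have h := ((hW.continuous_path ω).tendsto 0).comp hsn0
      rw [hW.apply_zero] at h
      exact h
    have hevA : ∀ᶠ n : ℕ in atTop, exPt (W ((n : ℝ≥0) + 1)⁻¹ ω) ∉ A := by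
      have hc : Tendsto (fun n : ℕ ↦ exPt (W ((n : ℝ≥0) + 1)⁻¹ ω)) atTop (𝓝 0) := by
        have h := (continuous_exPt.tendsto 0).comp h0
        rw [exPt_zero] at h
        exact h
      exact hc (hAc.isOpen_compl.mem_nhds hA.2)
    have hevD : ∀ᶠ n : ℕ in atTop, W ((n : ℝ≥0) + 1)⁻¹ ω ∈ exDom A := by
      filter_upwards [hevA] with n hn
      refine ⟨?_, hn⟩
      have h := hω ((n : ℝ≥0) + 1)⁻¹ (by positivity)
      rw [zero_add] at h
      exact h.ne'
    have hwithin : Tendsto (fun n : ℕ ↦ W ((n : ℝ≥0) + 1)⁻¹ ω) atTop (𝓝[exDom A] 0) :=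
      tendsto_nhdsWithin_iff.2 ⟨h0, hevD⟩
    refine ((tendsto_excursionRatio_nhdsWithin_zero hA hΦ hd).comp hwithin).congr' ?_
    filter_upwards [hevD] with n hn
    simp only [Function.comp_apply, indicator_of_mem hn]
  have h := tendsto_integral_of_dominated_convergence
    (F := fun (n : ℕ) ω ↦ (exDom A).indicator (excursionRatio Φ) (W ((n : ℝ≥0) + 1)⁻¹ ω))
    (fun _ ↦ (1 : ℝ))
    (fun n ↦ (hŪm.comp (hW.measurable _)).aestronglyMeasurable) (integrable_const 1)
    (fun n ↦ ae_of_all _ fun ω ↦ by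
      rw [Real.norm_eq_abs]
      exact abs_indicator_excursionRatio_le_one hA hΦ _) hlim
  simpa only [integral_const, probReal_univ, one_smul] using h

/-! ### [LSW] Prop. 4.1 -/

/-- **[LSW] Prop. 4.1 for a four-dimensional Brownian motion `W`: `P[∀ t, exPt (W_t) ∉ A] =
Φ'_A(0)` for every `A ∈ 𝒬*`** ("`P[B[0, ∞) ∩ A = ∅] = lim_{s→0} P[B[s, ∞) ∩ A = ∅] =
lim_{s→0} E[Im Φ(B_s)/Im B_s] = Φ'(0)`"): the hit events after the times `1/(n+1)` increase to
the hit event after time `0` (`exPt (W_0) = 0 ∉ A`), their probabilities are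
`1 − E[Ū(W_{1/(n+1)})] → 1 − Φ'_A(0)`. [cite: LawlerSchrammWerner2003Restriction, Prop. 4.1 (p. 16)] -/
theorem measure_forall_exPt_notMem [IsProbabilityMeasure P] (hW : IsBrownianVec W P)
    (hA : IsStarHull A) (hΦ : IsRestrictionMap A Φ) {d : ℝ} (hd : HasRestrictionDeriv A Φ d) :
    P {ω | ∀ t, exPt (W t ω) ∉ A} = ENNReal.ofReal d := by
  rcases A.eq_empty_or_nonempty with rfl | hne
  · rw [ExcursionCloud.eq_one_of_hasRestrictionDeriv_empty hΦ hd]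
    have h : {ω | ∀ t, exPt (W t ω) ∉ (∅ : Set ℂ)} = univ := eq_univ_of_forall fun ω t h ↦ h
    rw [h, measure_univ, ENNReal.ofReal_one]
  -- the hit events after time `s_n = 1/(n+1)`
  set sn : ℕ → ℝ≥0 := fun n ↦ ((n : ℝ≥0) + 1)⁻¹ with hsn
  have hsn_ne : ∀ n, sn n ≠ 0 := fun n ↦ by
    show ((n : ℝ≥0) + 1)⁻¹ ≠ 0
    positivity
  set Ev : ℕ → Set Ω := fun n ↦ {ω | ∃ j, W (sn n + j) ω ∈ exPt ⁻¹' A} with hEv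
  have hstep : ∀ n, MeasurableSet (Ev n) ∧
      P.real (Ev n) = 1 - ∫ ω, (exDom A).indicator (excursionRatio Φ) (W (sn n) ω) ∂P :=
    fun n ↦ measureReal_exists_mem_preimage_exPt hW hA hne hΦ (hsn_ne n)
  have hmono : Monotone Ev := by
    intro m n hmn ω hω
    obtain ⟨j, hj⟩ := hω
    have hle : sn n ≤ sn m := by
      show ((n : ℝ≥0) + 1)⁻¹ ≤ ((m : ℝ≥0) + 1)⁻¹
      gcongr
    refine ⟨sn m - sn n + j, ?_⟩
    show W (sn n + (sn m - sn n + j)) ω ∈ exPt ⁻¹' A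
    rwa [← add_assoc, add_tsub_cancel_of_le hle]
  have hUnion : (⋃ n, Ev n) = {ω | ∃ t, exPt (W t ω) ∈ A} := by
    ext ω
    simp only [mem_iUnion, hEv, mem_setOf_eq, mem_preimage]
    constructor
    · rintro ⟨n, j, hj⟩
      exact ⟨_, hj⟩
    · rintro ⟨t, ht⟩
      have ht0 : t ≠ 0 := by
        rintro rfl
        rw [hW.apply_zero, exPt_zero] at ht
        exact hA.2 ht
      obtain ⟨n, hn⟩ := exists_nat_one_div_lt (NNReal.coe_pos.2 (pos_iff_ne_zero.2 ht0))
      have hle : sn n ≤ t := by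
        show ((n : ℝ≥0) + 1)⁻¹ ≤ t
        rw [← NNReal.coe_le_coe]
        push_cast
        rw [← one_div]
        exact hn.le
      exact ⟨n, t - sn n, by rwa [add_tsub_cancel_of_le hle]⟩
  -- pass to the limit
  have h1 : Tendsto (fun n ↦ P.real (Ev n)) atTop (𝓝 (P.real (⋃ n, Ev n))) :=
    (ENNReal.tendsto_toReal (measure_ne_top _ _)).comp (tendsto_measure_iUnion_atTop hmono)
  have h2 : Tendsto (fun n ↦ P.real (Ev n)) atTop (𝓝 (1 - d)) := by
    refine ((tendsto_integral_indicator_excursionRatio hW hA hΦ hd).const_sub 1).congr fun n ↦ ?_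
    exact (hstep n).2.symm
  have hhit : P.real {ω | ∃ t, exPt (W t ω) ∈ A} = 1 - d := by
    rw [← hUnion]
    exact tendsto_nhds_unique h1 h2
  have hmeasU : MeasurableSet {ω | ∃ t, exPt (W t ω) ∈ A} := by
    rw [← hUnion]
    exact MeasurableSet.iUnion fun n ↦ (hstep n).1
  have hcompl : {ω | ∀ t, exPt (W t ω) ∉ A} = {ω | ∃ t, exPt (W t ω) ∈ A}ᶜ := by
    ext ω
    simp
  rw [hcompl, ← ofReal_measureReal (measure_ne_top _ _), measureReal_compl hmeasU, probReal_univ,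
    hhit, sub_sub_cancel]

/-! ### `P_1` exists -/

/-- **The two-sided restriction measure `P_1` exists, from any four-dimensional Brownian motion**
("We have just proved that the two-sided restriction measure `P_1` exists"): the tree's assembly
`exists_isRestrictionMeasure_one_of_excursionProcess` (the law of the filling of the excursion
path is `P_1`) fed with Prop. 4.1 (`measure_forall_exPt_notMem`) and the sample-path facts of
`Process/BrownianVecTransience`. [cite: LawlerSchrammWerner2003Restriction, §4 Prop. 4.1 (p. 16) and the sentence following its proof] -/
theorem exists_isRestrictionMeasure_one_of_isBrownianVec [IsProbabilityMeasure P]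
    (hW : IsBrownianVec W P) : ∃ P : Measure RestrictionConfig, IsRestrictionMeasure 1 P := by
  have hpolar : ∀ᵐ ω ∂P, ∀ t : ℝ≥0, 0 < t → exRad (W t ω) ≠ 0 := by
    filter_upwards [hW.ae_forall_pos_spRad_pos 0] with ω hω t ht
    have h := hω t ht
    rw [zero_add] at h
    exact h.ne'
  have htrans : ∀ᵐ ω ∂P, Tendsto (fun t ↦ exRad (W t ω)) atTop atTop := by
    filter_upwards [hW.ae_tendsto_spRad_atTop 0] with ω hω
    rw [spRad_eq_exRad] at hω
    simpa only [zero_add] using hω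
  exact exists_isRestrictionMeasure_one_of_excursionProcess hW.measurable hW.continuous_path
    hW.apply_zero hpolar htrans fun hA _ hΦ _ hd ↦ measure_forall_exPt_notMem hW hA hΦ hd

/-- **`P_1` exists** ([LSW] §4: Prop. 4.1 and "We have just proved that the two-sided
restriction measure `P_1` exists"), by the four independent canonical Brownian motions
`Process.brownianQuad` on `Process.wienerQuad`. [cite: LawlerSchrammWerner2003Restriction, §4 Prop. 4.1 (p. 16) and the sentence following its proof] -/
theorem exists_isRestrictionMeasure_one_brownianQuad :
    ∃ P : Measure RestrictionConfig, IsRestrictionMeasure 1 P :=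
  exists_isRestrictionMeasure_one_of_isBrownianVec isBrownianVec_brownianQuad

/-- **[LSW] p. 5, Thm.: chordal restriction measures supported on simple curves are `SLE_{8/3}`**
(the tree's `LawlerSchrammWerner2003`, through `LawlerSchrammWerner2003_of_exists_one`), now
unconditional. [cite: LawlerSchrammWerner2003Restriction, p. 5 result 2] -/
theorem LawlerSchrammWerner2003_brownianQuad : LawlerSchrammWerner2003 :=
  LawlerSchrammWerner2003_of_exists_one exists_isRestrictionMeasure_one_brownianQuad

end Literature.Probability.RandomPlanarGeometry

end
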